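import Summits.NavierStokesRegularity.NavierStokesRegularity.Theorems.RecurrentProfilesRecurrentLiouvillePrJointContinuity
import Summits.NavierStokesRegularity.NavierStokesRegularity.Theorems.RecurrentProfilesRecurrentReductionOrbit
import Literature.Dynamics.TopologicalDynamics.MinimalOrbitClosure
import Literature.Analysis.FluidPDE.ScalingUniformRecurrence
import Literature.Analysis.FluidPDE.ScalingRecurrentSlabField
import Mathlib.Topology.Metrizable.Uniformity
import HarnessLib

/-!
# Crux `RecurrentLiouville` (stmt-NavierStokesRegularity-1589), line `Sketch` (skeleton v9) — harvest
  stub `stub_prRecurrentHullSymmetric`: the `L³_loc` scaling hull of a uniformly recurrent field is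
  symmetric (Furstenberg 1981, Thm. 1.17, in `L³_loc` of the backward slab)

Theorems-only support file (no definitions, no named facts).

Write `Q(0, R) = ]-R², 0[ × B(0, R)` (`parabolicCylinder R 0`) for the backward parabolic ball at
the origin of `ℝ × ℝ³` and `u_c(t, x) = c u(c² t, c x)` (`nsRescale c u`) for the Navier–Stokes
rescaling of a space–time field; `u` is UNIFORMLY RECURRENT under scaling
(`IsScalingUniformlyRecurrent u`) if for every `ε > 0` and every compact `K ⊆ {t ≤ 0} × ℝ³` the
`ε`-return log-scales `{σ | ‖u_{e^σ} − u‖_{L³(K)} ≤ ε}` are relatively dense in `ℝ`.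

**Statement** (`stub_prRecurrentHullSymmetric`).  Let `u, v` lie in `L³(Q(0, R))` for every
`R > 0`, let `λₙ > 0` with `u_{λₙ} → v` in every `L³(Q(0, R))`, and let `u` be uniformly recurrent
under scaling.  Then `u` is approximated by rescalings of `v`: for every `ε > 0` and `R > 0` there is
`μ > 0` with `‖v_μ − u‖_{L³(Q(0, R))} ≤ ε`.  (The hull relation "lies in the `L³_loc` scaling-orbit
closure of" is symmetric on uniformly recurrent fields.)

**Proof** (Furstenberg 1981, Ch. 1 §4, Thm. 1.17: "the orbit closure of a uniformly recurrent
point is minimal", run in a concrete model).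
* MODEL.  The `L³_loc` slab-field space `Literature.Analysis.FluidPDE.SlabField ℝ³ ℝ³ 3` (fields
  lying in `L³(Q(0, R))` for every `R`, Fréchet topology of the seminorms `L³(Q(0, n+1))`;
  pseudo-metrisable, hence regular and sequential; convergence = convergence in every
  `L³(Q(0, R))`, `R > 0`).  Its scaling flow `SlabField.flow σ w = w_{e^σ}` satisfies the action law
  and is JOINTLY continuous on `ℝ × X` (sequentially, by `stub_prJointContinuity`).
* RECURRENCE.  The `L³(K)`-balls about a slab field, `K` compact in `{t ≤ 0} × ℝ³`, form a
  neighbourhood base, so the dictionary `SlabField.isUniformlyRecurrentPt_iff` makes `x₀ = u` a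
  uniformly recurrent point of the flow.
* HULL.  `ϕ (log λₙ) x₀ = u_{λₙ} → v`, so `y = v` lies in the orbit closure of `x₀`; by
  Furstenberg's Thm. 1.17 (`mem_closure_orbit_of_isUniformlyRecurrentPt`: joint continuity, action
  law, regularity) `x₀` lies in the orbit closure of `y`.
* EXTRACTION.  Given `ε, R`, the `L³(Q(0, R))`-ball of radius `ε` about `x₀` is a neighbourhood
  (`SlabField.ball_mem_nhds`), so it contains some `ϕ σ y = v_{e^σ}`; take `μ = e^σ`.

## References

* H. Furstenberg, *Recurrence in Ergodic Theory and Combinatorial Number Theory*, Princeton UP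
  (1981), Ch. 1 §4, Thm. 1.17 (the orbit closure of a uniformly recurrent point is minimal).
  [Furstenberg1981]
* D. Albritton, T. Barker, *Global weak Besov solutions of the Navier–Stokes equations and
  applications*, J. Math. Fluid Mech. 21 (2019), no. 43 = arXiv:1811.00502, §3 (the `L³_loc`
  setting of rescaled solutions on the backward slab). [AlbrittonBarker2019]
-/

noncomputable section

-- the sub-problem namespace repeats the summit name (D-0017 layout `Summit.<S>.<P>.Theorems`)
set_option linter.dupNamespace false

namespace Summit.NavierStokesRegularity.NavierStokesRegularity.Theorems

open MeasureTheory Set Function Filter Topology TopologicalSpace Metric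
open Literature.Analysis Literature.Analysis.FluidPDE
open Literature.Dynamics.TopologicalDynamics
open scoped NNReal ENNReal

/-- **The `L³_loc` scaling hull of a uniformly recurrent field is symmetric** (Furstenberg 1981,
Thm. 1.17, in the `L³_loc` model of the backward slab).  If `u, v ∈ L³(Q(0, R))` for all `R > 0`,
`λₙ > 0`, `u_{λₙ} → v` in every `L³(Q(0, R))` and `u` is uniformly recurrent under scaling, then for
every `ε > 0`, `R > 0` some rescaling `v_μ` (`μ > 0`) satisfies `‖v_μ − u‖_{L³(Q(0,R))} ≤ ε`.
Proof: model = the `L³_loc` slab-field space `SlabField ℝ³ ℝ³ 3` (pseudo-metrisable, regular);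
its scaling flow `SlabField.flow σ w = w_{e^σ}` is a jointly continuous action
(`stub_prJointContinuity`); `u` is a uniformly recurrent point (dictionary
`SlabField.isUniformlyRecurrentPt_iff`); `v` lies in the orbit closure of `u`
(`ϕ (log λₙ) u = u_{λₙ} → v`), hence `u` lies in the orbit closure of `v`
(`mem_closure_orbit_of_isUniformlyRecurrentPt`), and an orbit point `v_{e^σ}` in the
`L³(Q(0, R))`-ball of radius `ε` about `u` (a neighbourhood, `SlabField.ball_mem_nhds`) does it. [cite: Furstenberg1981, Ch. 1 §4, Thm. 1.17] -/
theorem stub_prRecurrentHullSymmetric :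
    ∀ (u v : ℝ → EuclideanSpace ℝ (Fin 3) → EuclideanSpace ℝ (Fin 3)) (lam : ℕ → ℝ),
      (∀ R : ℝ, 0 < R → MemLp (uncurry u) 3 (volume.restrict (parabolicCylinder R (0 : ℝ × EuclideanSpace ℝ (Fin 3))))) →
      (∀ R : ℝ, 0 < R → MemLp (uncurry v) 3 (volume.restrict (parabolicCylinder R (0 : ℝ × EuclideanSpace ℝ (Fin 3))))) →
      (∀ n, 0 < lam n) →
      (∀ R : ℝ, 0 < R → Tendsto (fun n => eLpNorm (uncurry (nsRescale (lam n) u) - uncurry v) 3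
        (volume.restrict (parabolicCylinder R (0 : ℝ × EuclideanSpace ℝ (Fin 3))))) atTop (𝓝 0)) →
      IsScalingUniformlyRecurrent u →
      ∀ ε : ℝ, 0 < ε → ∀ R : ℝ, 0 < R → ∃ μ : ℝ, 0 < μ ∧
        eLpNorm (uncurry (nsRescale μ v) - uncurry u) 3 (volume.restrict (parabolicCylinder R (0 : ℝ × EuclideanSpace ℝ (Fin 3)))) ≤ ENNReal.ofReal ε := by
  intro u v lam hu hv hlam hconv hrec
  classical
  haveI h13 : Fact (1 ≤ (3 : ℝ≥0∞)) := ⟨by norm_num⟩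
  -- ## the model: `u`, `v` as points of the `L³_loc` slab-field space `SlabField ℝ³ ℝ³ 3`
  let x₀ : SlabField (EuclideanSpace ℝ (Fin 3)) (EuclideanSpace ℝ (Fin 3)) 3 := SlabField.ofMemLp u hu
  let y : SlabField (EuclideanSpace ℝ (Fin 3)) (EuclideanSpace ℝ (Fin 3)) 3 := SlabField.ofMemLp v hv
  -- ## the scaling flow is JOINTLY continuous (sequentially, `stub_prJointContinuity`)
  have hjoint : Continuous fun p : ℝ × SlabField (EuclideanSpace ℝ (Fin 3)) (EuclideanSpace ℝ (Fin 3)) 3 =>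
      SlabField.flow p.1 p.2 := by
    refine continuous_iff_seqContinuous.2 fun x a hxa => ?_
    have h1 : Tendsto (fun k => (x k).1) atTop (𝓝 a.1) := hxa.fst_nhds
    have h2 := (SlabField.tendsto_iff_forall _ _).1 hxa.snd_nhds
    show Tendsto (fun k => SlabField.flow (x k).1 (x k).2) atTop (𝓝 (SlabField.flow a.1 a.2))
    rw [SlabField.tendsto_iff_forall]
    intro R' hR'
    exact stub_prJointContinuity (fun k => ((x k).2).toFun) a.2.toFun
      (fun k R hR => ((x k).2).memLp R) (fun R hR => a.2.memLp R) h2 (fun k => Real.exp (x k).1)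
      (Real.exp a.1) (fun k => Real.exp_pos _) (Real.exp_pos _)
      ((Real.continuous_exp.tendsto _).comp h1) R' hR'
  -- ## `x₀` is a uniformly recurrent point of the flow (dictionary)
  have hrecpt : IsUniformlyRecurrentPt
      (SlabField.flow (E := EuclideanSpace ℝ (Fin 3)) (F := EuclideanSpace ℝ (Fin 3)) (p := 3)) x₀ :=
    (SlabField.isUniformlyRecurrentPt_iff x₀).2 hrec
  -- ## `y` lies in the orbit closure of `x₀` ...
  have hy : y ∈ closure (range fun σ => SlabField.flow σ x₀) := by
    refine mem_closure_of_tendsto (f := fun n => SlabField.flow (Real.log (lam n)) x₀) (b := atTop) ?_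
      (Eventually.of_forall fun n => ⟨Real.log (lam n), rfl⟩)
    rw [SlabField.tendsto_iff_forall]
    intro R' hR'
    refine (hconv R' hR').congr fun n => ?_
    rw [SlabField.flow_log_toFun (hlam n)]
    rfl
  -- ## ... hence (Furstenberg 1.17) `x₀` lies in the orbit closure of `y`
  have hx₀ : x₀ ∈ closure (range fun t => SlabField.flow t y) :=
    mem_closure_orbit_of_isUniformlyRecurrentPt hjoint SlabField.flow_add hrecpt hy
  -- ## extraction on `Q(0, R)`
  intro ε hε R hR
  obtain ⟨q, hqV, σ, rfl⟩ :=
    mem_closure_iff_nhds.1 hx₀ _ (x₀.ball_mem_nhds R (ENNReal.ofReal_pos.2 hε))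
  exact ⟨Real.exp σ, Real.exp_pos σ, le_of_lt hqV⟩

end Summit.NavierStokesRegularity.NavierStokesRegularity.Theorems
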